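import Summits.KontsevichZagierPeriods.KontsevichZagierPeriods.Theses.HurwitzMicroSectors
import Literature.NumberTheory.Transcendental.KZCalculusProofs
import Literature.NumberTheory.Transcendental.KZKernelConjectureForms
import Summits.KontsevichZagierPeriods.KontsevichZagierPeriods.Theorems.StuffleInKZ.Negative.NewtonLeibnizFree
import Summits.KontsevichZagierPeriods.KontsevichZagierPeriods.Theorems.StuffleInKZ.Negative.ChangeOfVariablesFree
import Summits.KontsevichZagierPeriods.KontsevichZagierPeriods.Theorems.StuffleInKZ.Negative.IntegrandAdditivityDerived
import Summits.KontsevichZagierPeriods.KontsevichZagierPeriods.Theorems.StuffleInKZ.Negative.LoadBearing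
import Summits.KontsevichZagierPeriods.KontsevichZagierPeriods.Theorems.LogPrimitiveNL.Negative.Defs

/-!
# Crux `HurwitzMicroSectors.NormalFormPrinciple` (stmt-KontsevichZagierPeriods-3869) — negative side I:
the crux over the sub-calculi of the KZ rules

Landed copy (cdisprove, 2026-08-16) of the sorry-free core of `Cruxes/NormalFormPrinciple/Disproof.lean`,
REBASED on the negative knowledge already in the tree (cited and imported, not re-proved):
`HurwitzSectorComplement.Negative.nfp_iff_statement` (the crux IS the summit; cited, not imported),
`StuffleInKZ.Negative.nlFreeRelations` / `of_segRep_sub_of_unit_not_mem_nlFree` (rule 3 is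
independent), `StuffleInKZ.Negative.covFreeRelations` / `swapWitness_not_mem_covFreeRelations`
(rule 2 is independent, algebraic-shadow invariant), `StuffleInKZ.Negative.Derived.relations_eq_closure_three_rules`
(rule 1b is derivable), `StuffleInKZ.Negative.covNLRelations` (rules 2 + 3 only). New here:

* §0 the RELATIVE forms `NormalFormPrincipleMod S`, `ConjectureMod S` of the crux / of Conjecture 1
  over a subgroup `S` of formal relations, the relative assembly `normalFormPrincipleMod_iff`, and
  the refutation template `not_normalFormPrincipleMod_of_witness`;
* §1 `normalFormPrinciple_iff_kernel`, `rigidity_univ_iff_statement`; §2 the obstruction shape as a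
  biconditional for THIS crux (`not_normalFormPrinciple_iff_invariant`);
* §3 THE CRUX OVER SUB-CALCULI: FALSE without rule 3 (`normalFormPrinciple_false_nlFree`), FALSE
  without rule 2 (`normalFormPrinciple_false_covFree`), FALSE without rule 1
  (`normalFormPrinciple_false_covNL`, new invariant `emptyCount`: only rule 1 disposes of the empty
  representation), UNCHANGED without rule 1b (`normalFormPrincipleMod_three_rules_iff`) — so a proof
  of the crux uses rules 1a, 2, 3 and may avoid 1b;
* §4 refuted strengthening: no family with finitely many VALUES reduces all rational
  representations (`not_exists_finite_values`).

A second, arithmetic invariant of `covFreeRelations` (windowed value mod `ℚ̄`, complementary to the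
algebraic shadow) is in `WindowInvariant.lean`. References: [KontsevichZagier2001, §1.2].
-/

noncomputable section

set_option linter.dupNamespace false

open MeasureTheory Set
open Literature.NumberTheory.Transcendental Literature.NumberTheory.Transcendental.KZ
open Literature.ModelTheory.ExponentialFields (IsSemialgebraic)

namespace Summit.KontsevichZagierPeriods.HurwitzMicroSectors.NormalFormPrinciple.Negative

open Summit.KontsevichZagierPeriods.KontsevichZagierPeriods.Theses.HurwitzMicroSectors
  (NormalFormPrinciple)
open Summit.KontsevichZagierPeriods.Theorems.StuffleInKZ.Negative
  (nlFreeRelations nlFreeRelations_le_relations segRep value_segRep of_segRep_sub_of_unit_not_mem_nlFree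
   covFreeRelations covFreeRelations_le_relations swapWitness_not_mem_covFreeRelations
   covNLRelations covNLRelations_le_relations)
open Summit.KontsevichZagierPeriods.Theorems.StuffleInKZ.Negative.Derived (relations_eq_closure_three_rules)
open Summit.KontsevichZagierPeriods.Theorems.StuffleInKZ.Negative.Swap
  (box boxRep₁ boxRep₂ boxRep₁_domain boxRep₂_domain eval_swapWitness invSum)
open Summit.KontsevichZagierPeriods.LiouvilleUnfolding.LogPrimitiveNL.Negative
  (ptRep value_ptRep integrand_ptRep domain_ptRep)

variable {n m : ℕ}

/-! ## §0 The two halves, relative to a subgroup of formal relations -/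

/-- A family of "normal forms", one set of representations per dimension. -/
abbrev Family : Type := (n : ℕ) → Set (IntegralRep n)

/-- Rigidity half of the crux relative to a subgroup `S ⊆ FormalRep` (`S = relations` is the
crux's): members of `𝒩` with equal values differ by an element of `S`. -/
def RigidityMod (S : AddSubgroup FormalRep) (𝒩 : Family) : Prop :=
  ∀ (n m : ℕ) (N : IntegralRep n) (N' : IntegralRep m),
    N ∈ 𝒩 n → N' ∈ 𝒩 m → N.value = N'.value → of N - of N' ∈ S

/-- Reduction half of the crux relative to `S`: every rational representation differs from a
member of `𝒩` by an element of `S`. -/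
def ReductionMod (S : AddSubgroup FormalRep) (𝒩 : Family) : Prop :=
  ∀ (n : ℕ) (r : IntegralRep n), r.IsRational →
    ∃ (m : ℕ) (N : IntegralRep m), N ∈ 𝒩 m ∧ of r - of N ∈ S

/-- The crux relative to a subgroup of formal relations. -/
def NormalFormPrincipleMod (S : AddSubgroup FormalRep) : Prop :=
  ∃ 𝒩 : Family, RigidityMod S 𝒩 ∧ ReductionMod S 𝒩

/-- Conjecture 1 (two rational representations) relative to a subgroup of formal relations. -/
def ConjectureMod (S : AddSubgroup FormalRep) : Prop :=
  ∀ (n m : ℕ) (r : IntegralRep n) (r' : IntegralRep m),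
    r.IsRational → r'.IsRational → r.value = r'.value → of r - of r' ∈ S

/-- The crux IS `NormalFormPrincipleMod relations` (definitional). -/
theorem normalFormPrinciple_iff_mod : NormalFormPrinciple ↔ NormalFormPrincipleMod relations :=
  Iff.rfl

/-- Values are preserved by any subgroup of sound relations. -/
theorem value_eq_of_sub_mem {S : AddSubgroup FormalRep} (hS : S ≤ eval.ker)
    {a b : ℕ} (ra : IntegralRep a) (rb : IntegralRep b) (h : of ra - of rb ∈ S) :
    ra.value = rb.value := by
  have := hS h
  rwa [AddMonoidHom.mem_ker, map_sub, eval_of, eval_of, sub_eq_zero] at this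

/-- **Assembly, relative form.** Over any SOUND subgroup `S` (values preserved), normal forms give
Conjecture 1 relative to `S`: reduce both sides, compare values, apply rigidity, compose. -/
theorem conjectureMod_of_normalFormPrincipleMod {S : AddSubgroup FormalRep} (hS : S ≤ eval.ker)
    (h : NormalFormPrincipleMod S) : ConjectureMod S := by
  obtain ⟨𝒩, hrig, hred⟩ := h
  intro n m r r' hr hr' hv
  obtain ⟨k, N, hN, hrN⟩ := hred n r hr
  obtain ⟨k', N', hN', hrN'⟩ := hred m r' hr'
  have hNN' : N.value = N'.value := by
    rw [← value_eq_of_sub_mem hS r N hrN, ← value_eq_of_sub_mem hS r' N' hrN', hv]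
  have h3 := hrig k k' N N' hN hN' hNN'
  have : of r - of r' = (of r - of N) + (of N - of N') - (of r' - of N') := by abel
  rw [this]
  exact S.sub_mem (S.add_mem hrN h3) hrN'

/-- Conversely Conjecture 1 relative to `S` gives normal forms relative to `S`
(`𝒩 :=` the rational representations themselves). -/
theorem normalFormPrincipleMod_of_conjectureMod {S : AddSubgroup FormalRep} (h : ConjectureMod S) :
    NormalFormPrincipleMod S :=
  ⟨fun _ => {r | r.IsRational}, fun n m N N' hN hN' hv => h n m N N' hN hN' hv,
    fun n r hr => ⟨n, r, hr, by rw [sub_self]; exact S.zero_mem⟩⟩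

/-- Over a sound subgroup, normal forms ⇔ Conjecture 1. -/
theorem normalFormPrincipleMod_iff {S : AddSubgroup FormalRep} (hS : S ≤ eval.ker) :
    NormalFormPrincipleMod S ↔ ConjectureMod S :=
  ⟨conjectureMod_of_normalFormPrincipleMod hS, normalFormPrincipleMod_of_conjectureMod⟩

/-! ## §1 Summit strength (the crux IS the summit: `HurwitzSectorComplement.Negative.nfp_iff_statement`) -/

/-- The crux is the kernel form `ker eval = relations` of the period conjecture. (The summit
equivalence `NormalFormPrinciple ↔ KontsevichZagierPeriods` is the landed
`HurwitzSectorComplement.Negative.nfp_iff_statement`; here it is read off the relative assembly.) -/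
theorem normalFormPrinciple_iff_kernel : NormalFormPrinciple ↔ KZKernelConjecture := by
  rw [normalFormPrinciple_iff_mod, normalFormPrincipleMod_iff relations_le_ker_eval_holds,
    kzKernelConjecture_iff_isRational]
  exact ⟨fun h n m r r' hr hr' hv => h n m r r' hr hr' hv, fun h n m r r' hr hr' hv => h r r' hr hr' hv⟩

/-- The negation of the crux is route Neg's thesis `¬ KontsevichZagierPeriods`. -/
theorem not_normalFormPrinciple_iff : ¬ NormalFormPrinciple ↔ ¬ KontsevichZagierPeriods :=
  not_congr (normalFormPrinciple_iff_kernel.trans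
    (kzKernelConjecture_iff_isRational.trans KontsevichZagierPeriods_iff.symm))

/-- No free lunch at the other extreme: rigidity for `𝒩 = univ` is the summit again
(all-representations form `KZPeriodConjecture'` ⇔ rational form). -/
theorem rigidity_univ_iff_statement : RigidityMod relations (fun _ => univ) ↔ KontsevichZagierPeriods := by
  have h1 : RigidityMod relations (fun _ => univ) ↔ KZPeriodConjecture' :=
    ⟨fun h n m r r' hv => h n m r r' (mem_univ _) (mem_univ _) hv,
      fun h n m r r' _ _ hv => h r r' hv⟩
  rw [h1, kzPeriodConjecture'_iff_isRational]
  rfl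

/-! ## §2 Obstruction shape for this crux -/

/-- **Obstruction shape (biconditional).** The crux fails iff some additive invariant of the
formal group kills all four move sets yet separates one pair of equal-valued RATIONAL
representations. (→: the quotient map `FormalRep → FormalRep ⧸ relations`; ←: `closure_le`.)
Any refutation — of this crux, of the summit, of route Neg's cruxes — must exhibit such an `ι`. -/
theorem not_normalFormPrinciple_iff_invariant :
    ¬ NormalFormPrinciple ↔
      ∃ (A : Type) (_ : AddCommGroup A) (ι : FormalRep →+ A),
        (∀ c ∈ domainAddRel ∪ integrandAddRel ∪ changeOfVariablesRel ∪ newtonLeibnizRel, ι c = 0) ∧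
        ∃ (n m : ℕ) (r : IntegralRep n) (r' : IntegralRep m),
          r.IsRational ∧ r'.IsRational ∧ r.value = r'.value ∧ ι (of r - of r') ≠ 0 := by
  rw [not_normalFormPrinciple_iff]
  constructor
  · intro h
    have h' : ∃ (n m : ℕ) (r : IntegralRep n) (r' : IntegralRep m),
        r.IsRational ∧ r'.IsRational ∧ r.value = r'.value ∧ ¬ Equivalent r r' := by
      by_contra hne
      apply h
      intro n m r r' hr hr' hv
      by_contra hE
      exact hne ⟨n, m, r, r', hr, hr', hv, hE⟩
    obtain ⟨n, m, r, r', hr, hr', hv, hne⟩ := h'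
    refine ⟨FormalRep ⧸ relations, inferInstance, QuotientAddGroup.mk' relations, ?_,
      n, m, r, r', hr, hr', hv, ?_⟩
    · intro c hc
      exact (QuotientAddGroup.eq_zero_iff c).mpr (AddSubgroup.subset_closure hc)
    · intro h0
      exact hne ((QuotientAddGroup.eq_zero_iff _).mp h0)
  · rintro ⟨A, _, ι, hι, n, m, r, r', hr, hr', hv, hne⟩ h
    apply hne
    have hle : relations ≤ ι.ker := (AddSubgroup.closure_le _).mpr fun c hc => hι c hc
    exact hle (h r r' hr hr' hv)

/-! ## §3 The crux over the sub-calculi of the KZ rules -/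

/-- General refutation template for a sub-calculus: a sound subgroup `S` and one equal-valued
rational pair outside `S` kill the crux relative to `S`. -/
theorem not_normalFormPrincipleMod_of_witness {S : AddSubgroup FormalRep} (hS : S ≤ eval.ker)
    {a b : ℕ} (r : IntegralRep a) (r' : IntegralRep b) (hr : r.IsRational) (hr' : r'.IsRational)
    (hv : r.value = r'.value) (hno : of r - of r' ∉ S) : ¬ NormalFormPrincipleMod S :=
  fun h => hno (conjectureMod_of_normalFormPrincipleMod hS h a b r r' hr hr' hv)

/-! ### Without rule 3 (`nlFreeRelations = closure (1a ∪ 1b ∪ 2)`, tree): FALSE -/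

/-- `[pt, 1]` has KZ's rational shape. -/
theorem isRational_unit : IntegralRep.unit.IsRational :=
  ⟨1, 1, fun _ _ => by simp, fun _ _ => by simp⟩

/-- `∫₀¹ dt` (`StuffleInKZ.Negative.segRep`) has KZ's rational shape. -/
theorem isRational_segRep : segRep.IsRational :=
  ⟨1, 1, fun _ _ => by simp, fun _ _ => by simp [segRep]⟩

/-- **Any proof of the crux uses rule 3).** Over the Newton–Leibniz-free sub-calculus the crux is
FALSE: `∫₀¹ dt` and `[pt, 1]` are rational of value `1` and `∫₀¹ dt − [pt,1] ∉ nlFreeRelations`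
(tree: graded evaluation, `StuffleInKZ.Negative.of_segRep_sub_of_unit_not_mem_nlFree`). -/
theorem normalFormPrinciple_false_nlFree : ¬ NormalFormPrincipleMod nlFreeRelations :=
  not_normalFormPrincipleMod_of_witness (nlFreeRelations_le_relations.trans relations_le_ker_eval_holds)
    segRep IntegralRep.unit isRational_segRep isRational_unit
    (by rw [value_segRep, IntegralRep.value_unit]) of_segRep_sub_of_unit_not_mem_nlFree

/-! ### Without rule 2 (`covFreeRelations = closure (1a ∪ 1b ∪ 3)`, tree): FALSE -/

/-- `[(0,1)×(1,2), dz/(z₀+z₁)]` has KZ's rational shape. -/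
theorem isRational_boxRep₁ : boxRep₁.IsRational := by
  refine ⟨1, MvPolynomial.X 0 + MvPolynomial.X 1, fun z hz => ?_, fun z _ => ?_⟩
  · rw [boxRep₁_domain] at hz
    obtain ⟨h0, -, h1, -⟩ := hz
    have : (0:ℝ) < z 0 + z 1 := by push_cast at h0 h1; linarith
    simpa using this.ne'
  · show invSum z = _
    simp [invSum]

/-- `[(1,2)×(0,1), dz/(z₀+z₁)]` has KZ's rational shape. -/
theorem isRational_boxRep₂ : boxRep₂.IsRational := by
  refine ⟨1, MvPolynomial.X 0 + MvPolynomial.X 1, fun z hz => ?_, fun z _ => ?_⟩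
  · rw [boxRep₂_domain] at hz
    obtain ⟨h0, -, h1, -⟩ := hz
    have : (0:ℝ) < z 0 + z 1 := by push_cast at h0 h1; linarith
    simpa using this.ne'
  · show invSum z = _
    simp [invSum]

/-- **Any proof of the crux uses rule 2).** Over the change-of-variables-free sub-calculus the crux
is FALSE: the swap pair `[(0,1)×(1,2), dz/(z₀+z₁)]`, `[(1,2)×(0,1), dz/(z₀+z₁)]` is rational,
equal-valued (one change of variables apart), and not CoV-free-related (tree: algebraic shadow,
`StuffleInKZ.Negative.swapWitness_not_mem_covFreeRelations`). A second witness with a different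
invariant — the arctangent reflection pair, INVISIBLE to the algebraic shadow — is in
`WindowInvariant.lean`. -/
theorem normalFormPrinciple_false_covFree : ¬ NormalFormPrincipleMod covFreeRelations := by
  refine not_normalFormPrincipleMod_of_witness (covFreeRelations_le_relations.trans relations_le_ker_eval_holds)
    boxRep₁ boxRep₂ isRational_boxRep₁ isRational_boxRep₂ ?_ swapWitness_not_mem_covFreeRelations
  have h := eval_swapWitness
  rwa [map_sub, eval_of, eval_of, sub_eq_zero] at h

/-! ### Without rule 1 (`covNLRelations = closure (2 ∪ 3)`, tree): FALSE — the empty representation -/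

open Classical in
/-- **The invariant**: the number of generators with empty domain. -/
def emptyCount : FormalRep →+ ℤ :=
  FreeAbelianGroup.lift fun r => if r.2.domain = ∅ then 1 else 0

open Classical in
/-- `emptyCount` of a generator. -/
@[simp] theorem emptyCount_of (r : IntegralRep n) :
    emptyCount (of r) = if r.domain = ∅ then 1 else 0 := by
  simp [emptyCount, of]

/-- A change of variables maps an empty domain to an empty domain and a non-empty one to a
non-empty one. -/
theorem emptyCount_eq_zero_of_mem_changeOfVariablesRel {c : FormalRep} (hc : c ∈ changeOfVariablesRel) :
    emptyCount c = 0 := by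
  obtain ⟨k, r, r', Φ, Φ', -, -, -, hdom, -, rfl⟩ := hc
  have : r'.domain = ∅ ↔ r.domain = ∅ := by rw [hdom, image_eq_empty]
  by_cases h : r.domain = ∅
  · simp [h, this.mpr h]
  · simp [h, mt this.mp h]

/-- A Newton–Leibniz band over `τ` with `a ≤ b` is empty iff `τ` is. -/
theorem emptyCount_eq_zero_of_mem_newtonLeibnizRel {c : FormalRep} (hc : c ∈ newtonLeibnizRel) :
    emptyCount c = 0 := by
  obtain ⟨k, r, r', a, b, F, -, -, -, hab, hdom, -, -, -, rfl⟩ := hc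
  have hiff : r.domain = ∅ ↔ r'.domain = ∅ := by
    constructor
    · intro h
      by_contra hne
      obtain ⟨x, hx⟩ := nonempty_iff_ne_empty.mpr hne
      have : (Fin.snoc x (a x) : Fin (k + 1) → ℝ) ∈ r.domain := by
        rw [hdom]
        simp [hx, hab x hx]
      rw [h] at this
      exact this
    · intro h
      rw [hdom, eq_empty_iff_forall_notMem]
      intro z hz
      have : Fin.init z ∈ r'.domain := hz.1
      rw [h] at this
      exact this
  by_cases h : r'.domain = ∅
  · simp [h, hiff.mpr h]
  · simp [h, mt hiff.mp h]

/-- **Rules 2, 3 preserve `emptyCount`.** -/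
theorem covNLRelations_le_ker_emptyCount : covNLRelations ≤ emptyCount.ker := by
  refine (AddSubgroup.closure_le _).mpr ?_
  rintro c (hc | hc)
  · exact emptyCount_eq_zero_of_mem_changeOfVariablesRel hc
  · exact emptyCount_eq_zero_of_mem_newtonLeibnizRel hc

/-- `[pt, q]` (`LogPrimitiveNL.Negative.ptRep`) has KZ's rational shape. -/
theorem isRational_ptRep (q : ℚ) : (ptRep q).IsRational :=
  ⟨MvPolynomial.C q, 1, fun _ _ => by simp, fun _ _ => by simp⟩

/-- `[∅, 0]` has KZ's rational shape (vacuously). -/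
theorem isRational_empty : (IntegralRep.empty 0).IsRational := ⟨0, 1, fun _ h => h.elim, fun _ h => h.elim⟩

/-- `emptyCount` separates `[∅, 0]` from `[pt, 0]`. -/
theorem emptyCount_witness : emptyCount (of (IntegralRep.empty 0) - of (ptRep 0)) = 1 := by
  simp

/-- `[∅, 0] − [pt, 0]` is not a relation of the calculus without rule 1). -/
theorem witness_not_mem_covNLRelations : of (IntegralRep.empty 0) - of (ptRep 0) ∉ covNLRelations := by
  intro h
  have := covNLRelations_le_ker_emptyCount h
  rw [AddMonoidHom.mem_ker, emptyCount_witness] at this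
  exact one_ne_zero this

/-- **Any proof of the crux uses rule 1).** Over the sub-calculus generated by change of variables
and Newton–Leibniz, `[∅, 0]` and `[pt, 0]` (rational, value `0`) are separated by `emptyCount`
(degenerate but honest: only rule 1 disposes of the empty representation,
`KZ.IntegralRep.of_empty_mem_relations`; the tree's augmentation `StuffleInKZ.Negative.aug` does not
separate two single representations). -/
theorem normalFormPrinciple_false_covNL : ¬ NormalFormPrincipleMod covNLRelations :=
  not_normalFormPrincipleMod_of_witness (covNLRelations_le_relations.trans relations_le_ker_eval_holds)
    (IntegralRep.empty 0) (ptRep 0) isRational_empty (isRational_ptRep 0)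
    (by rw [IntegralRep.value_empty, value_ptRep, Rat.cast_zero]) witness_not_mem_covNLRelations

/-! ### Without rule 1b: UNCHANGED (`StuffleInKZ.Negative.Derived.relations_eq_closure_three_rules`, tree) -/

/-- The crux over the calculus without integrand additivity is the crux itself. -/
theorem normalFormPrincipleMod_three_rules_iff :
    NormalFormPrincipleMod (AddSubgroup.closure (domainAddRel ∪ changeOfVariablesRel ∪ newtonLeibnizRel)) ↔
      NormalFormPrinciple := by
  rw [← relations_eq_closure_three_rules]
  exact normalFormPrinciple_iff_mod.symm

/-! ## §4 A refuted natural strengthening: finitely many normal VALUES -/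

/-- **No finite set of normal VALUES suffices**: a family `𝒩` to which every rational
representation reduces (by sound relations) takes infinitely many values, since every rational
number is the value of a rational representation (`ptRep q`). In particular `NormalFormPrinciple`
cannot be strengthened to a finite `𝒩`. -/
theorem not_exists_finite_values {S : AddSubgroup FormalRep} (hS : S ≤ eval.ker) :
    ¬ ∃ 𝒩 : Family, (⋃ n, IntegralRep.value '' 𝒩 n).Finite ∧ ReductionMod S 𝒩 := by
  rintro ⟨𝒩, hfin, hred⟩
  have hsub : range (fun q : ℚ => (q : ℝ)) ⊆ ⋃ n, IntegralRep.value '' 𝒩 n := by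
    rintro _ ⟨q, rfl⟩
    obtain ⟨m, N, hN, hqN⟩ := hred 0 (ptRep q) (isRational_ptRep q)
    refine mem_iUnion.mpr ⟨m, N, hN, ?_⟩
    rw [← value_eq_of_sub_mem hS _ _ hqN, value_ptRep]
  exact ((infinite_range_of_injective Rat.cast_injective).mono hsub) hfin

/-- The crux itself cannot be witnessed by a family with finitely many values. -/
theorem not_exists_finite_values_relations :
    ¬ ∃ 𝒩 : Family, (⋃ n, IntegralRep.value '' 𝒩 n).Finite ∧ ReductionMod relations 𝒩 :=
  not_exists_finite_values relations_le_ker_eval_holds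

end Summit.KontsevichZagierPeriods.HurwitzMicroSectors.NormalFormPrinciple.Negative
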